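import Literature.AlgebraicGeometry.HodgeTheory.QuarticCMTwoOnePowersHodgeClasses
import Literature.AlgebraicGeometry.HodgeTheory.CMHodgeGroupPowersHodgeClasses
import Mathlib.FieldTheory.IntermediateField.Adjoin.Basic
import Mathlib.FieldTheory.Minpoly.Field
import Mathlib.FieldTheory.Minpoly.Finite
import HarnessLib

/-!
# The eigenvalues of `φ^*` on `H¹` of a SIMPLE abelian variety generate fields of degree `deg minpoly(φ^*)`; for the type IV(2,1) fourfolds of TABLE X rows 23–25 (`End⁰(Y)` of rank `4`, four distinct eigenvalues `μ₁, μ̄₁, μ₂, μ̄₂`) the field `ℚ(μ₂)` has degree `4` (Mumford §19 Cor. 2; Shimura §5.1 Prop. 2; Moonen–Zarhin 1999 (2.1))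

Family `hodge`, layer `Literature/AlgebraicGeometry/HodgeTheory`, namespace `Literature.AlgebraicGeometry.HodgeTheory`.
THEOREMS ONLY: no definition, no named fact, no `sorry` (D-0026). Written for the cell `pub-hodgeav-hg6` (req-37 (A)
Q2b, TABLE X row 25), seat eng-2 g7, task T1b (lead g4 2026-08-29T07:41:59Z GO). HONEST FRAMING: HC ∕ HC_AV
(stmt-1333) ∕ HC_CM (stmt-3052) ∕ H2 are NOT proved and do not occur here; this file is linear algebra on `H¹`.

WHAT. The row-25 summit theorems `TableX.ProductRows.isStablyNondegenerate_row25_biquadraticCentre` /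
`hodgeConjectureFor_row25_biquadraticCentre` (`Summits/…/SixfoldTableXRow25NonAligned`, v3) display the member datum
`h4μ : finrank ℚ ℚ⟮μ₂⟯ = 4` next to the class binders of the quartic-centre fourfold `Y` (`Y` simple, `finrank_ℚ End⁰(Y) = 4`,
`φ_Y` with eigenvalues `μ₁` (multiplicity `1`), `μ̄₁` (`1`), `μ₂` (`2`) on `H^{1,0}`, pairwise distinct and off each
other's conjugates). This file DISCHARGES `h4μ` from those binders:
* §1 `aeval_eq_zero_of_eigenspace_baseChange_ne_bot` — an eigenvalue of `b_ℂ` is a complex root of every rational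
  polynomial killing `b`.
* §2 **`irreducible_minpoly_bettiMapHom_of_isSimple`** — for `A` SIMPLE and `W_c(φ^*_ℂ) ≠ 0` for some `c`, the minimal
  polynomial over `ℚ` of `φ^* ∈ End_ℚ H¹(A; ℚ)` is irreducible: `End_Hdg(H¹A) ≅ End⁰(A)ᵒᵖ` is a division algebra
  (`exists_mul_eq_one_of_mem_endAlg_of_isSimple`, Mumford §19 Cor. 2), hence a domain, and `minpoly.irreducible`;
  **`minpoly_eigenvalue_eq_minpoly_bettiMapHom_of_isSimple`**: `minpoly_ℚ c = minpoly_ℚ(φ^*)` for every eigenvalue `c`,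
  so **`finrank_adjoin_eigenvalue_eq_natDegree_minpoly_of_isSimple`**: `[ℚ(c):ℚ] = deg minpoly_ℚ(φ^*)`.
* §3 **`finrank_adjoin_eigenvalue_eq_four_of_isSimple_of_finrank_eq_four`** — if moreover `finrank_ℚ End⁰(A) = 4` and
  `φ^*_ℂ` has four distinct eigenvalues `c₀, …, c₃`, then `[ℚ(c_j):ℚ] = 4` for each `j` (`4` distinct roots `≤ deg ≤
  finrank End_Hdg = 4`, `minpoly.natDegree_le`, `finrank_endAlg_hodge_one`); **`finrank_adjoin_eq_four_of_quarticCM_twoOne`**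
  — the TABLE X form with the R10 binders `hYs hE4 h11 h22 h12 h12'` and `h1 : mult(μ₁) ≠ 0`, `h2 : mult(μ₂) ≠ 0`
  (the eigenspaces at `μ₁, μ̄₁, μ₂, μ̄₂` are non-zero by the dictionary
  `finrank_eigenspace_inf_piece_{oneZero,zeroOne}_eq_eigenMultiplicity(_conj)` and `CMTheta.finrank_eigenspace_eq_add`):
  `finrank ℚ ℚ⟮μ₂⟯ = 4 ∧ finrank ℚ ℚ⟮μ₁⟯ = 4`.

IN PRINT. Mumford, *Abelian Varieties*, §19 Cor. 2 of Thm. 1 (`End⁰` of a simple abelian variety is a division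
algebra); Shimura, *Abelian Varieties with Complex Multiplication…*, §5.1 Prop. 2 (the characteristic polynomial of the
rational representation is a power of the minimal polynomial); Moonen–Zarhin, Math. Ann. 315 (1999), §2 (2.1)–(2.2)
(`E = End⁰(X)` a CM field acting on `H¹` through its embeddings `σ : E ↪ ℂ`, the eigenvalues of `φ` being the
`σ(φ)`). Adapter-class statement (standard facts assembled for the tree's binders).

## References
* [MumfordAV1970] D. Mumford, *Abelian Varieties* (1970), §19 Cor. 2 of Thm. 1 (p. 174).
* [Shimura1998] G. Shimura, *Abelian Varieties with Complex Multiplication and Modular Functions* (1998), §5.1 Prop. 2.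
* [MoonenZarhin1999LowDim] B. Moonen, Yu. Zarhin, Math. Ann. 315 (1999), §2 (2.1)–(2.2).
-/

noncomputable section

open scoped TensorProduct IntermediateField
open CategoryTheory Module Polynomial

namespace Literature.AlgebraicGeometry.HodgeTheory

open Literature.AlgebraicTopology.SingularHomology
open Literature.AlgebraicGeometry.Motives (IsSmoothProjective AbelianVariety bettiCohomology HodgeTensorFacts
  hodgeTensorFacts_holds)
open Literature.AlgebraicGeometry.Motives.HodgeStructure
open Literature.AlgebraicGeometry.ComplexMultiplication (bettiRep bettiRep_of)

/-! ### §1 Eigenvalues of the base change are roots of every rational annihilating polynomial -/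

section Roots

universe u

variable {V : Type u} [AddCommGroup V] [Module ℚ V]

/-- `aeval (b_ℂ) p = (aeval b p)_ℂ` for a rational polynomial `p` (`baseChange` is an algebra homomorphism,
`Module.End.baseChangeHom`). [cite: MoonenZarhin1999LowDim, §2 (2.1)] -/
private theorem aeval_baseChange_eq' (b : Module.End ℚ V) (p : ℚ[X]) :
    aeval (b.baseChange ℂ) p = (aeval b p).baseChange ℂ := by
  have h : b.baseChange ℂ = Module.End.baseChangeHom ℚ ℂ V b := rfl
  rw [h, aeval_algHom_apply]
  rfl

/-- **An eigenvalue of `b_ℂ` is a complex root of every rational polynomial killing `b`**: if `aeval b p = 0` and the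
eigenspace of `b_ℂ = b ⊗ 1` at `c ∈ ℂ` is non-zero, then `p(c) = 0` (apply `p(b_ℂ) = p(b)_ℂ = 0` to an eigenvector:
`p(c) · v = 0`, `v ≠ 0`). (MZ99 (2.1): the eigenvalues of `φ ∈ E = End⁰` on `H¹ ⊗ ℂ` are the `σ(φ)`, roots of its minimal
polynomial.) [cite: MoonenZarhin1999LowDim, §2 (2.1)–(2.2)] -/
theorem aeval_eq_zero_of_eigenspace_baseChange_ne_bot (b : Module.End ℚ V) {p : ℚ[X]} (hp : aeval b p = 0) {c : ℂ}
    (hc : Module.End.eigenspace (b.baseChange ℂ) c ≠ ⊥) : aeval c p = 0 := by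
  obtain ⟨v, hv, hv0⟩ := (Submodule.ne_bot_iff _).1 hc
  have hev : Module.End.HasEigenvector (b.baseChange ℂ) c v := Module.End.hasEigenvector_iff.2 ⟨hv, hv0⟩
  have h1 : aeval (b.baseChange ℂ) (p.map (algebraMap ℚ ℂ)) v = (p.map (algebraMap ℚ ℂ)).eval c • v :=
    Module.End.aeval_apply_of_hasEigenvector hev
  rw [aeval_map_algebraMap, aeval_baseChange_eq', hp, LinearMap.baseChange_zero, LinearMap.zero_apply, eq_comm,
    smul_eq_zero] at h1
  rcases h1 with h1 | h1
  · rw [aeval_def, ← Polynomial.eval_map]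
    exact h1
  · exact absurd h1 hv0

end Roots

/-! ### §2 Simple abelian varieties: the minimal polynomial of `φ^*` is irreducible and is the minimal polynomial of each eigenvalue -/

section Simple

variable {A : AbelianVariety ℂ}

/-- **For `A` SIMPLE (with `H¹(A) ⊗ ℂ` carrying a non-zero eigenspace of `φ^*_ℂ`) the minimal polynomial over `ℚ` of
`φ^* ∈ End_ℚ H¹(A(ℂ); ℚ)` is IRREDUCIBLE**: `φ^*` lies in `End_Hdg(H¹A) ≅ End⁰(A)ᵒᵖ`, a division algebra for simple `A`
(`exists_mul_eq_one_of_mem_endAlg_of_isSimple`), hence a domain, in which minimal polynomials are irreducible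
(`minpoly.irreducible`), and the minimal polynomial does not change along `End_Hdg ↪ End_ℚ H¹`.
[cite: MumfordAV1970, §19 Cor. 2 of Thm. 1 (p. 174)] [cite: Shimura1998, §5.1 Prop. 2] -/
theorem irreducible_minpoly_bettiMapHom_of_isSimple (hA : A.IsSimple) (φ : A ⟶ A) {c : ℂ}
    (hc : Module.End.eigenspace (((bettiCohomology.map φ.hom.hom.hom 1).hom).baseChange ℂ) c ≠ ⊥) :
    Irreducible (minpoly ℚ ((bettiCohomology.map φ.hom.hom.hom 1).hom)) := by
  classical
  have hHD : exists_isReal_hodgeModel := exists_isReal_hodgeModel_holds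
  have hI : hodgePQ_independent_of_hodgeModel := hodgePQ_independent_of_hodgeModel_holds
  haveI : Module.Finite ℚ (bettiCohomology A.X 1) := finite_bettiCohomology_one A
  set H := BettiUniverse.hodge hHD (AbelianVariety.isSmoothProjective_holds (A := A)) 1 with hHdef
  set φQ : Module.End ℚ (bettiCohomology A.X 1) := (bettiCohomology.map φ.hom.hom.hom 1).hom with hφQ
  have hφE : φQ ∈ H.endAlg := by
    have h := unop_bettiRep_mem_endAlg hHD hI (AbelianVariety.endAlgebra.of A φ)
    rwa [bettiRep_of, MulOpposite.unop_op] at h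
  -- `H¹(A; ℚ)` is non-zero (it carries a non-zero complex eigenspace), so `End_ℚ H¹` and `End_Hdg` are nontrivial
  haveI : Nontrivial (ℂ ⊗[ℚ] bettiCohomology A.X 1) := by
    obtain ⟨v, -, hv0⟩ := (Submodule.ne_bot_iff _).1 hc
    exact nontrivial_of_ne v 0 hv0
  haveI : Nontrivial (bettiCohomology A.X 1) := by
    by_contra h
    haveI : Subsingleton (bettiCohomology A.X 1) := not_nontrivial_iff_subsingleton.1 h
    exact not_subsingleton (ℂ ⊗[ℚ] bettiCohomology A.X 1) inferInstance
  haveI : Nontrivial H.endAlg :=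
    ⟨⟨0, 1, fun h => zero_ne_one (congrArg (fun a : H.endAlg => (a : Module.End ℚ (bettiCohomology A.X 1))) h)⟩⟩
  -- `End_Hdg(H¹ A)` has no zero divisors (left inverses of non-zero elements)
  have hinv := exists_mul_eq_one_of_mem_endAlg_of_isSimple hHD hI hA
  haveI : NoZeroDivisors H.endAlg := by
    refine ⟨fun {a b} hab => ?_⟩
    by_cases ha : a = 0
    · exact Or.inl ha
    · refine Or.inr (Subtype.ext ?_)
      have ha' : (a : Module.End ℚ (bettiCohomology A.X 1)) ≠ 0 := fun h => ha (Subtype.ext h)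
      obtain ⟨a', ha'a⟩ := hinv a a.2 ha'
      have hab' : (a : Module.End ℚ (bettiCohomology A.X 1)) * b = 0 := congrArg Subtype.val hab
      calc (b : Module.End ℚ (bettiCohomology A.X 1)) = a' * a * b := by rw [ha'a, one_mul]
        _ = 0 := by rw [mul_assoc, hab', mul_zero]
  haveI : IsDomain H.endAlg := NoZeroDivisors.to_isDomain _
  haveI : Module.Finite ℚ H.endAlg := Module.Finite.of_injective H.endAlg.val.toLinearMap Subtype.val_injective
  have hirr : Irreducible (minpoly ℚ (⟨φQ, hφE⟩ : H.endAlg)) :=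
    minpoly.irreducible (Algebra.IsIntegral.isIntegral _)
  rwa [← minpoly.algHom_eq H.endAlg.val Subtype.val_injective (⟨φQ, hφE⟩ : H.endAlg)] at hirr

/-- **For `A` simple, every eigenvalue `c` of `φ^*_ℂ` on `H¹(A) ⊗ ℂ` has `minpoly_ℚ c = minpoly_ℚ(φ^*)`** (the latter is
irreducible, monic and kills `c`). [cite: MumfordAV1970, §19 Cor. 2 of Thm. 1 (p. 174)] [cite: MoonenZarhin1999LowDim, §2 (2.1)–(2.2)] -/
theorem minpoly_eigenvalue_eq_minpoly_bettiMapHom_of_isSimple (hA : A.IsSimple) (φ : A ⟶ A) {c : ℂ}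
    (hc : Module.End.eigenspace (((bettiCohomology.map φ.hom.hom.hom 1).hom).baseChange ℂ) c ≠ ⊥) :
    minpoly ℚ c = minpoly ℚ ((bettiCohomology.map φ.hom.hom.hom 1).hom) := by
  haveI : Module.Finite ℚ (bettiCohomology A.X 1) := finite_bettiCohomology_one A
  set φQ : Module.End ℚ (bettiCohomology A.X 1) := (bettiCohomology.map φ.hom.hom.hom 1).hom with hφQ
  have hint : IsIntegral ℚ φQ := Algebra.IsIntegral.isIntegral _
  exact (minpoly.eq_of_irreducible_of_monic (irreducible_minpoly_bettiMapHom_of_isSimple hA φ hc)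
    (aeval_eq_zero_of_eigenspace_baseChange_ne_bot φQ (minpoly.aeval ℚ φQ) hc) (minpoly.monic hint)).symm

/-- **For `A` simple, `[ℚ(c):ℚ] = deg minpoly_ℚ(φ^*)` for every eigenvalue `c` of `φ^*_ℂ`** (`c` is algebraic with minimal
polynomial `minpoly_ℚ(φ^*)`, `IntermediateField.adjoin.finrank`). [cite: MumfordAV1970, §19 Cor. 2 of Thm. 1 (p. 174)]
[cite: MoonenZarhin1999LowDim, §2 (2.1)–(2.2)] -/
theorem finrank_adjoin_eigenvalue_eq_natDegree_minpoly_of_isSimple (hA : A.IsSimple) (φ : A ⟶ A) {c : ℂ}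
    (hc : Module.End.eigenspace (((bettiCohomology.map φ.hom.hom.hom 1).hom).baseChange ℂ) c ≠ ⊥) :
    Module.finrank ℚ ℚ⟮c⟯ = (minpoly ℚ ((bettiCohomology.map φ.hom.hom.hom 1).hom)).natDegree := by
  haveI : Module.Finite ℚ (bettiCohomology A.X 1) := finite_bettiCohomology_one A
  set φQ : Module.End ℚ (bettiCohomology A.X 1) := (bettiCohomology.map φ.hom.hom.hom 1).hom with hφQ
  have hint : IsIntegral ℚ φQ := Algebra.IsIntegral.isIntegral _
  have hcint : IsIntegral ℚ c :=
    ⟨minpoly ℚ φQ, minpoly.monic hint, by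
      rw [← aeval_def]; exact aeval_eq_zero_of_eigenspace_baseChange_ne_bot φQ (minpoly.aeval ℚ φQ) hc⟩
  rw [IntermediateField.adjoin.finrank hcint, minpoly_eigenvalue_eq_minpoly_bettiMapHom_of_isSimple hA φ hc]

/-! ### §3 Rank `4` and four distinct eigenvalues: `[ℚ(c):ℚ] = 4` -/

/-- **`[ℚ(c_j):ℚ] = 4`.** For `A` SIMPLE with `finrank_ℚ End⁰(A) = 4` and `φ : A → A` whose `φ^*_ℂ` has four distinct
eigenvalues `c₀, …, c₃` (non-zero eigenspaces) on `H¹(A) ⊗ ℂ`, every `c_j` generates a field of degree `4` over `ℚ`: the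
irreducible `minpoly_ℚ(φ^*) = minpoly_ℚ c_j` (§2) has the four distinct complex roots `c_j` (§1), so degree `≥ 4`, and
degree `≤ finrank_ℚ End_Hdg(H¹A) = finrank_ℚ End⁰(A) = 4` (`minpoly.natDegree_le`, `finrank_endAlg_hodge_one`); hence
`E = ℚ(φ) = End⁰(A)` is a quartic field and `ℚ(c_j) ≅ E`. [cite: Shimura1998, §5.1 Prop. 2]
[cite: MoonenZarhin1999LowDim, §2 (2.1)–(2.2)] [cite: MumfordAV1970, §19 Cor. 2 of Thm. 1 (p. 174)] -/
theorem finrank_adjoin_eigenvalue_eq_four_of_isSimple_of_finrank_eq_four (hA : A.IsSimple)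
    (hE4 : Module.finrank ℚ A.endAlgebra = 4) (φ : A ⟶ A) (c : Fin 4 → ℂ) (hcinj : Function.Injective c)
    (hW : ∀ j, Module.End.eigenspace (((bettiCohomology.map φ.hom.hom.hom 1).hom).baseChange ℂ) (c j) ≠ ⊥)
    (j : Fin 4) : Module.finrank ℚ ℚ⟮c j⟯ = 4 := by
  classical
  have hHD : exists_isReal_hodgeModel := exists_isReal_hodgeModel_holds
  have hI : hodgePQ_independent_of_hodgeModel := hodgePQ_independent_of_hodgeModel_holds
  haveI : Module.Finite ℚ (bettiCohomology A.X 1) := finite_bettiCohomology_one A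
  set H := BettiUniverse.hodge hHD (AbelianVariety.isSmoothProjective_holds (A := A)) 1 with hHdef
  set φQ : Module.End ℚ (bettiCohomology A.X 1) := (bettiCohomology.map φ.hom.hom.hom 1).hom with hφQ
  have hφE : φQ ∈ H.endAlg := by
    have h := unop_bettiRep_mem_endAlg hHD hI (AbelianVariety.endAlgebra.of A φ)
    rwa [bettiRep_of, MulOpposite.unop_op] at h
  have hint : IsIntegral ℚ φQ := Algebra.IsIntegral.isIntegral _
  rw [finrank_adjoin_eigenvalue_eq_natDegree_minpoly_of_isSimple hA φ (hW j)]
  refine le_antisymm ?_ ?_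
  · -- `deg ≤ finrank End_Hdg = 4`
    haveI : Module.Finite ℚ H.endAlg := Module.Finite.of_injective H.endAlg.val.toLinearMap Subtype.val_injective
    have h := minpoly.natDegree_le (A := ℚ) (⟨φQ, hφE⟩ : H.endAlg)
    rw [← minpoly.algHom_eq H.endAlg.val Subtype.val_injective (⟨φQ, hφE⟩ : H.endAlg)] at h
    have hrank : Module.finrank ℚ H.endAlg = 4 := by rw [hHdef, finrank_endAlg_hodge_one hHD hI, hE4]
    rw [hrank] at h
    exact h
  · -- the four distinct roots `c j`
    set m := minpoly ℚ φQ with hm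
    have hm0 : m.map (algebraMap ℚ ℂ) ≠ 0 := Polynomial.map_ne_zero (minpoly.ne_zero hint)
    have hroots : ∀ i, c i ∈ (m.map (algebraMap ℚ ℂ)).roots := fun i => by
      rw [mem_roots hm0, IsRoot.def, Polynomial.eval_map, ← aeval_def]
      exact aeval_eq_zero_of_eigenspace_baseChange_ne_bot φQ (minpoly.aeval ℚ φQ) (hW i)
    have hsub : (Finset.univ.image c).val ≤ (m.map (algebraMap ℚ ℂ)).roots := by
      rw [Finset.val_le_iff_val_subset]
      intro x hx
      have hx' : x ∈ Finset.univ.image c := hx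
      obtain ⟨i, -, rfl⟩ := Finset.mem_image.1 hx'
      exact hroots i
    have hcard : (Finset.univ.image c).card = 4 := by
      rw [Finset.card_image_of_injective _ hcinj, Finset.card_univ, Fintype.card_fin]
    calc 4 = Multiset.card (Finset.univ.image c).val := by rw [Finset.card_val, hcard]
      _ ≤ Multiset.card (m.map (algebraMap ℚ ℂ)).roots := Multiset.card_le_card hsub
      _ ≤ (m.map (algebraMap ℚ ℂ)).natDegree := card_roots' _
      _ = m.natDegree := natDegree_map _

/-- **TABLE X form (the R10 ∕ row-25 binders): `finrank ℚ ℚ⟮μ₂⟯ = 4` and `finrank ℚ ℚ⟮μ₁⟯ = 4`** for `Y` SIMPLE with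
`finrank_ℚ End⁰(Y) = 4` and `φ_Y` with eigenvalues `μ₁, μ₂` of NON-ZERO multiplicity on `H^{1,0}(Y)` such that
`μ̄₁ ≠ μ₁`, `μ̄₂ ≠ μ₂`, `μ₂ ≠ μ₁`, `μ₂ ≠ μ̄₁`: the four eigenspaces of `φ_Y^*` at `μ₁, μ̄₁, μ₂, μ̄₂` are non-zero
(`dim W_c = mult(c) + mult(c̄)`, the `finrank_eigenspace_inf_piece_…_eq_eigenMultiplicity` dictionary) and pairwise
distinct, and §3 applies. Discharges the member datum `h4μ` of
`TableX.ProductRows.isStablyNondegenerate_row25_biquadraticCentre` (take `h1 = 1 ≠ 0`, `h2 = 2 ≠ 0`).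
[cite: Shimura1998, §5.1 Prop. 2] [cite: MoonenZarhin1999LowDim, §2 (2.1)–(2.2) and (2.5)]
[cite: MumfordAV1970, §19 Cor. 2 of Thm. 1 (p. 174)] -/
theorem finrank_adjoin_eq_four_of_quarticCM_twoOne {Y : AbelianVariety ℂ} (hYs : Y.IsSimple)
    (hE4 : Module.finrank ℚ Y.endAlgebra = 4) (φY : Y ⟶ Y) {μ₁ μ₂ : ℂ} (h11 : starRingEnd ℂ μ₁ ≠ μ₁)
    (h22 : starRingEnd ℂ μ₂ ≠ μ₂) (h12 : μ₂ ≠ μ₁) (h12' : μ₂ ≠ starRingEnd ℂ μ₁) (h1 : eigenMultiplicity Y φY μ₁ ≠ 0)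
    (h2 : eigenMultiplicity Y φY μ₂ ≠ 0) :
    Module.finrank ℚ ℚ⟮μ₂⟯ = 4 ∧ Module.finrank ℚ ℚ⟮μ₁⟯ = 4 := by
  classical
  haveI : HodgeTensorFacts.{0, 0} := hodgeTensorFacts_holds
  have hHD : exists_isReal_hodgeModel := exists_isReal_hodgeModel_holds
  have hI : hodgePQ_independent_of_hodgeModel := hodgePQ_independent_of_hodgeModel_holds
  have hXY : IsSmoothProjective Y.dim Y.X := AbelianVariety.isSmoothProjective_holds
  haveI : Module.Finite ℚ (bettiCohomology Y.X 1) := finite_bettiCohomology_one Y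
  have hn1 : (((1 : ℕ) : ℤ)) = 1 := Nat.cast_one
  have heff := BettiUniverse.hodge_isEffective hHD hXY 1
  set φQ : Module.End ℚ (bettiCohomology Y.X 1) := (bettiCohomology.map φY.hom.hom.hom 1).hom with hφQ
  have hφE : φQ ∈ (BettiUniverse.hodge hHD hXY 1).endAlg := by
    have h := unop_bettiRep_mem_endAlg hHD hI (AbelianVariety.endAlgebra.of Y φY)
    rwa [bettiRep_of, MulOpposite.unop_op] at h
  -- the four eigenvalues
  have h21 : starRingEnd ℂ μ₂ ≠ μ₁ := fun h => h12' (by rw [← h, starRingEnd_self_apply])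
  set c4 : Fin 4 → ℂ := ![μ₁, starRingEnd ℂ μ₁, μ₂, starRingEnd ℂ μ₂] with hc4
  have hc4inj : Function.Injective c4 := by
    intro i j hij
    fin_cases i <;> fin_cases j
    all_goals simp [hc4] at hij
    all_goals first
      | rfl
      | exact absurd hij h11.symm | exact absurd hij h11 | exact absurd hij h12.symm | exact absurd hij h12
      | exact absurd hij h21.symm | exact absurd hij h21
      | exact absurd hij (fun h => h12' (by rw [← h, starRingEnd_self_apply]))
      | exact absurd hij (fun h => h12' (by rw [h, starRingEnd_self_apply]))
      | exact absurd hij (fun h => h12 (RingHom.injective _ h))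
      | exact absurd hij (fun h => h12 (RingHom.injective _ h).symm)
      | exact absurd hij h12' | exact absurd hij h12'.symm
      | exact absurd hij h22 | exact absurd hij h22.symm
  -- the eigenspace dictionary: `dim W_c = mult(c) + mult(c̄)`
  have hgr := fun cc => CMTheta.finrank_eigenspace_eq_add (BettiUniverse.hodge hHD hXY 1) hn1 heff hφE cc
  have h10 : ∀ cc, Module.finrank ℂ ↥(Module.End.eigenspace (φQ.baseChange ℂ) cc ⊓
      (BettiUniverse.hodge hHD hXY 1).piece 1 0) = eigenMultiplicity Y φY cc := fun cc => by
    rw [hφQ, finrank_eigenspace_inf_piece_oneZero_eq_eigenMultiplicity hHD hI φY cc]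
  have h01 : ∀ cc, Module.finrank ℂ ↥(Module.End.eigenspace (φQ.baseChange ℂ) cc ⊓
      (BettiUniverse.hodge hHD hXY 1).piece 0 1) = eigenMultiplicity Y φY (starRingEnd ℂ cc) := fun cc => by
    rw [hφQ, finrank_eigenspace_inf_piece_zeroOne_eq_eigenMultiplicity_conj hHD hI φY cc]
  have hpos : ∀ j, 0 < Module.finrank ℂ ↥(Module.End.eigenspace (φQ.baseChange ℂ) (c4 j)) := by
    intro j
    rw [hgr, h10, h01]
    fin_cases j
    · show 0 < eigenMultiplicity Y φY μ₁ + eigenMultiplicity Y φY (starRingEnd ℂ μ₁); omega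
    · show 0 < eigenMultiplicity Y φY (starRingEnd ℂ μ₁) + eigenMultiplicity Y φY (starRingEnd ℂ (starRingEnd ℂ μ₁))
      rw [starRingEnd_self_apply]; omega
    · show 0 < eigenMultiplicity Y φY μ₂ + eigenMultiplicity Y φY (starRingEnd ℂ μ₂); omega
    · show 0 < eigenMultiplicity Y φY (starRingEnd ℂ μ₂) + eigenMultiplicity Y φY (starRingEnd ℂ (starRingEnd ℂ μ₂))
      rw [starRingEnd_self_apply]; omega
  have hW : ∀ j, Module.End.eigenspace (φQ.baseChange ℂ) (c4 j) ≠ ⊥ := fun j hj => by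
    have h := hpos j; rw [hj, finrank_bot] at h; exact lt_irrefl 0 h
  have h4 := finrank_adjoin_eigenvalue_eq_four_of_isSimple_of_finrank_eq_four hYs hE4 φY c4 hc4inj hW
  have e2 : c4 2 = μ₂ := by simp [hc4]
  have e0 : c4 0 = μ₁ := by simp [hc4]
  exact ⟨e2 ▸ h4 2, e0 ▸ h4 0⟩

end Simple

end Literature.AlgebraicGeometry.HodgeTheory

end
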